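import Mathlib
import HarnessLib
import HarnessLib.Audit
import Summits.AtomisticToContinuum.Statement
import Literature.MathematicalPhysics.KineticTheory.LangevinChainKernel
import Literature.MathematicalPhysics.KineticTheory.LangevinChainGibbs
import Literature.MathematicalPhysics.KineticTheory.LangevinChainNESS
import Literature.MathematicalPhysics.KineticTheory.LangevinChainNESSHolds
import HarnessLib.Audit.Status.Attr

/-!
Route: BondHeatUncertainty

DORMANT since 2026-08-25T16:18:05Z (reconciler: no traction for 7.8 d (last activity item-evidence-added at 2026-08-17T19:19:10Z); parked, not closed — `ledger route dormant route-AtomisticToContinuum-BondHeatUncertainty --off` to react) — unstaffed, not closed; items shared with open routes are served there. `ledger route dormant <id> --off` reactivates.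

# Route BondHeatUncertainty — linear-response fluctuation-theorem uncertainty relation: sqrt(t)
bond-heat variance + extensive snapshot irreversibility => G_N = O(kappa/N)

X = (S) ∧ (K) ∧ (★): "it suffices to show" three statements, realising idea card
AtomisticToContinuum/FouriersLaw/lr-ftur-conductance-scaling (spine; its retired twin
ftur-transfer-bond-heat-variance is the same text). CONFORMING RE-OPEN (D-0027 §2.1) of route
BondHeatFTUR, retired 2026-08-15T13:41Z by the operator audit because its Assembly named the
Literature constant instead of the sub-problem Statement: same items, and the DECIDING THEOREM
`closes : TransferToBoundedResponse → SubdiffusiveBondHeat → ExtensiveSnapshotIrreversibility →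
LinearResponseFTUR → NessUnique → FiniteResponseOfUnique → PositiveOrInfiniteLimit → FouriersLaw` is
now PROVED (sorry-free, ~70 lines, planner folder glue.lean, axioms
propext/Classical.choice/Quot.sound) against the Statement decl `FouriersLaw`. Notation: P =
pinnedChain ω₂ lam β γ (all four > 0), T > 0; C_N(b,s) := ∫ j_b(z) (P_s j_b)(z) dμ_T^N(z) is the
EQUILIBRIUM autocorrelation of the energy current through bond (b,b+1) of the N-site chain with BOTH
Langevin baths at T (constructed kernels OscillatorChain.transitionKernel P N T T s and
OscillatorChain.gibbsMeasure P N T, as in route EscapeDeficit); V_N(b,t) := 2∫_0^t (t−s) C_N(b,s) ds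
= Var_eq(Q_t^(b)), Q_t^(b) = ∫_0^t j_b, the equilibrium BOND-HEAT VARIANCE; D_N = lim_{δ→0}
totalCurrent(μ_{N,T+δ/2,T−δ/2})/δ the BLR response coefficient of clause (ii) and G_N := D_N/(N−1)
the conductance; K_N := limsup_{δ→0} δ⁻² KL(μ_{N,δ} ‖ Θ_*μ_{N,δ}) the SNAPSHOT IRREVERSIBILITY of
the steady state (Θ = momentum flip; K_N = 2‖h_N^odd‖²_{L²(μ_T)}, the L²-size of the odd part of the
linear-response density).
(S) SubdiffusiveBondHeat (rank 2): ∃ A, c > 0: for all large N some bond b_N has V_N(b_N,t) ≤ A√t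
for 1 ≤ t ≤ cN² (Edwards–Wilkinson ¼-law of the single-bond heat up to the Thouless time).
(K) ExtensiveSnapshotIrreversibility (rank 3): ∃ C: KL(μ_{N,δ} ‖ Θ_*μ_{N,δ}) ≤ C·N·δ² for δ near 0,
every N.
(★) LinearResponseFTUR (rank 4, fixed N): D_N ≥ 0 and 2 G_N² t² ≤ V_N(b,t) · (G_N t/T² + K) for
every bond b, every t > 0 and every K ≥ 0 with KL(μ_{N,δ} ‖ Θ_*μ_{N,δ}) ≤ Kδ² eventually —
Hasegawa–Van Vu's fluctuation-theorem uncertainty relation for the Θ̃-odd observable Q_t^(b),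
divided by 2δ² in BLR's order δ → 0, using ⟨Σ_t⟩ = σt + KL(μ‖Θ_*μ), σ = G_Nδ²/T².
Then, by real arithmetic at t = cN² with K = CN (support TransferToBoundedResponse, PROVED
sorry-free in the planner folder): 0 ≤ D_N ≤ B(T) for all N, i.e. the shared waypoint
BoundedResponse (stmt-2187 = HasBoundedResponse for pinnedChain, crux of FeketeResistance, support
of LocalOhmRigidity/TwoChannelDephasing) is DISCHARGED; and from the light-cone version of (S) alone
(LightConeBondHeat, t ≤ aN) G_N ≤ c₁N^(−1/2) + c₂N^(−1/4) → 0, i.e. NonBallistic (stmt-2192, crux of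
SuperadditiveJunction) is discharged (TransferToNonBallistic, PROVED). FouriersLaw = BoundedResponse
+ the complement every line needs: clause (i) (fact CuneoEckmannHairerReyBellet2018_pinnedChain,
PROVED, + NessUnique 0741), existence of D_N (FiniteResponseOfUnique 0717) and convergence of D_N in
(0,+∞] (import slot PositiveOrInfiniteLimit = "not insulating + non-oscillation", the output of the
Fekete / superadditive-junction engines).
Lean: `SubdiffusiveBondHeat ∧ ExtensiveSnapshotIrreversibility ∧ LinearResponseFTUR`

## Assembly
Glue (elementary, ~100 lines, same pattern as FeketeResistance/SuperadditiveJunction assemblies):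
fix parameters > 0. Clause (i): existence from the PROVED fact
CuneoEckmannHairerReyBellet2018_pinnedChain (N ≥ 1) / OscillatorChain.isSteadyState_zero (N = 0),
uniqueness from NessUnique. BoundedResponse from TransferToBoundedResponse fed with (S), (K), (★),
NessUnique. Clause (ii): choose the canonical family μ₀ (choice from (i); junk at non-positive
temperatures) and, for T > 0, D₀(T) from FiniteResponseOfUnique; PositiveOrInfiniteLimit gives ℓ ∈
(0,+∞] ⊂ EReal with D₀ → ℓ; BoundedResponse gives |D₀ N| ≤ S, so ℓ ≤ S < ⊤, ℓ = ↑κ_T with κ_T > 0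
real and D₀ → κ_T in ℝ (EReal.tendsto_coe); set κ T := κ_T for T > 0, 1 otherwise. For an arbitrary
steady-state family μ, uniqueness gives μ N a b = μ₀ N a b for a, b > 0, so the difference quotients
agree for |δ| < 2T and D₀(T) serves as its response sequence (Filter.Tendsto.congr',
tendsto_nhds_unique, as in hasBoundedResponse_iff_of_unique); This is exactly the PROVED deciding
theorem `closes` (glue.lean, rendered into the route file by `--closes-file`); the fact
CuneoEckmannHairerReyBellet2018_pinnedChain is used through its in-tree proof `_holds`, so it is not
a hypothesis.

Rationale: WHY THIS LINE. A steady current through a bond makes the bond's heat record distinguishable from its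
time-reverse; distinguishability is capped by the path-space entropy production, which at linear
response is EXACTLY σt + KL(μ‖Θ_*μ) with σ = G_Nδ²/T² proportional to the current itself — so the
fluctuation-theorem uncertainty relation (HasegawaVanVu2019 arXiv:1902.06376;
underdamped/initial-state term VanVuHasegawa2019 arXiv:1901.05715; HCR/χ² form DechantSasa2020;
long-time TUR book:gaspard2022-statistical-mechanics-irreversible-phenomena p.389 eq. (5.114), which
SATURATES at linear response by the open-chain Kubo identity KunduDharNarayan2009) caps the
conductance by how noisy the bond heat is AT EQUILIBRIUM at FINITE t: 2G_N²t² ≤ Var_eq(Q_t)(G_Nt/T²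
+ K_N). Imported area: information geometry / stochastic thermodynamics (Cramér–Rao–type
inequalities, Gallavotti–Cohen/Evans–Searles fluctuation theorem, proved at fixed N for exactly
these chains: ReyBelletThomas2002AHP, EckmannPilletReyBellet1999b), used as a TRANSFER device from
equilibrium dynamics to NESS scaling. Evaluated at the Thouless time t = cN², a √t
(first-absolute-moment, Edwards–Wilkinson) spreading bound — strictly weaker than the
second-moment/Green–Kubo statement behind route FourierGreenKubo (MendlSpohn2015 arXiv:1412.4609 §4,
Spohn2014; model case SSEP doi:10.1023/a:1014577928229) — plus an extensive bound on the static
snapshot irreversibility give G_N = O(1/N) with explicit constant, i.e. HasBoundedResponse, WITHOUT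
κ = κ_GK, resolvent convergence, relaxation rates, local equilibrium or hydrodynamic limits; the
inequality amplifies the plain Cauchy–Schwarz use of the same static object (card
static-irreversibility-loschmidt-echo needs ‖h^odd‖² = O(1/N)) by a factor N², and with light-cone
data only (t ≤ aN, where the open chain is the infinite chain by finite speed of propagation,
ButtaEtAl2007) it already yields G_N → 0, the cheapest sufficient condition for non-ballisticity on
the ledger. No prior route uses an information inequality; the negatives index is empty.

RANKED CRUXES. #2 SubdiffusiveBondHeat (crux) — (S) card item U2. For P = pinnedChain ω₂ lam β γ
(all > 0) and T > 0, with C_N(b,s) = ∫ j_b · (P_s j_b) dμ_T^N (constructed transitionKernel at equal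
bath temperatures T, gibbsMeasure) and V_N(b,t) = 2∫_0^t (t−s)C_N(b,s)ds the equilibrium variance of
the heat Q_t^(b) through bond (b,b+1): ∃ A, c > 0, N₀ such that every N ≥ N₀ has a bond b (b+1 < N;
the prover picks it, e.g. the middle bond) with V_N(b,t) ≤ A√t for all 1 ≤ t ≤ cN². Reading: by
conservation V = 2Σ_z|z|[S(z,0) − S(z,t)] + boundary terms (MendlSpohn2015 §4 (4.6)), so this bounds
the FIRST ABSOLUTE MOMENT of equilibrium energy spreading by √t up to the Thouless time — implied by
(Cauchy–Schwarz), and strictly weaker than, a diffusive second-moment / Green–Kubo bound; it asks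
nothing about convergence of ∫C_J or κ = κ_GK. Model case: √t (fBM-¼) bond-current fluctuations of
SSEP (De Masi–Ferrari; Peligrad–Sethuraman). Only the value t = cN² is consumed by the transfer; the
window form is the natural statement and contains LightConeBondHeat. [difficulty: XL] (why it might
fail: A diffusive (EW ¼-law) bound for a deterministic anharmonic chain — nothing of the kind is
proved (BLR2000 §6.3); it encodes the cancellation ∫C_b ≈ T²G_N ≈ 0 at rate s^(-3/2) up to t ~ N²;
fails if energy spreads superdiffusively or bath-injected heat decorrelates slower than
diffusively.) [MendlSpohn2015, Spohn2014, doi:10.1023/a:1014577928229, arXiv:0711.0017,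
BonettoLebowitzReyBellet2000, KunduDharNarayan2009, ButtaEtAl2007]
#3 ExtensiveSnapshotIrreversibility (crux) — (K) card item U3. Under weak-NESS uniqueness, for every
steady-state family μ of pinnedChain ω₂ lam β γ (all > 0) and T > 0: ∃ C such that for every N,
eventually as δ → 0 (δ ≠ 0), KL(μ_{N,T+δ/2,T−δ/2} ‖ Θ_*μ_{N,T+δ/2,T−δ/2}) ≤ C·N·δ², Θ(q,p) = (q,−p)
(Mathlib InformationTheory.klDiv, Measure.map). Reading: K_N := limsup δ⁻²KL =
2‖h_N^odd‖²_{L²(μ_T)}, h^odd = ½∫_0^∞(P_s − P_s^*)ρ_src ds the odd part of the linear-response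
density — 'how much of the arrow of time is visible in one snapshot of the steady state'. Extensive
is generous: kinetic/diffusive phenomenology gives K_N = O(1) (local odd corrections O(δ/N) per site
plus long-range pair correlations O(δ/N)), and the BALLISTIC harmonic chain has K_N ≈ 0.16·N (exact
Gaussian computation, Numbers) — all the diffusive input of the line sits in (S). N = 0, 1: KL = 0.
Expected engine: locality of the odd response (odd corrector = gradient × cell correctors), NOT ‖h‖
≤ ‖ρ_src‖/gap. [difficulty: L] (why it might fail: No a priori bound on K_N = 2‖h_odd‖² beyond gap⁻²
(gap ≲ γ/N always; N⁻³ harmonic, BeckerMenegaki2022); long-range odd NESS correlations could make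
K_N ~ N^k, k > 1 (k ≤ 1 needed for boundedness, k < 3 for G_N → 0); KL finite needs a positive
smooth density.) [VanVuHasegawa2019, EckmannPilletReyBellet1999b, CuneoEckmannHairerReyBellet2018,
BeckerMenegaki2022, RiederLebowitzLieb1967, BonettoLebowitzReyBellet2000]
#4 LinearResponseFTUR (crux) — (★) card item U1, the engine, FIXED N. Under weak-NESS uniqueness,
for every steady-state family μ, T > 0 and response coefficients D (the δ-limits of clause (ii)):
for every N ≥ 2, (a) D_N ≥ 0 (entropy production ⟨Σ_t⟩ = σt + KL ≥ 0 for all t forces σ = G_Nδ²/T² +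
o(δ²) ≥ 0), and (b) for every bond b, every t > 0 and every K ≥ 0 with KL(μ_{N,δ}‖Θ_*μ_{N,δ}) ≤ Kδ²
eventually: 2G_N²t² ≤ V_N(b,t)·(G_N t/T² + K), G_N = D_N/(N−1), V_N as in (S). Derivation (checked
by a refuter audit and, numerically, on the harmonic chain — Numbers): Σ_t := log
dP_δ^[0,t]/dΘ̃_*P_δ^[0,t] (Θ̃ = time reversal ∘ momentum flip of the stationary path measure)
satisfies the joint detailed fluctuation theorem with the Θ̃-odd Q_t^(b), hence Hasegawa–Van Vu:
⟨Q_t⟩² ≤ ½Var_δ(Q_t)(e^{⟨Σ_t⟩} − 1) at every δ; ⟨Q_t⟩ = G_Nδt(1+o(1)) (equal mean bond currents),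
⟨Σ_t⟩ = σ_δ t + KL(μ_δ‖Θ_*μ_δ) with σ_δ = J_δ(1/T_R − 1/T_L) (EckmannPilletReyBellet1999b;
ReyBelletThomas2002AHP), Var_δ(Q_t) → V_N(b,t) as δ → 0 (Gibbs invariance + Markov property of the
constructed kernels: Var_eq(∫_0^t j_b) = 2∫_0^t(t−s)C_N(b,s)ds since μ_T(j_b) = 0); divide by δ² and
let δ → 0. Saturates as t → ∞ (V ~ 2T²G_N t, KunduDharNarayan2009: TUR is tight at linear response),
so all information sits at finite t; at t → 0 it reduces to the Cauchy–Schwarz bound K_N ≥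
2G_N²/⟨j_b²⟩. [difficulty: L] (why it might fail: Fixed N but delicate: needs P_δ ~ Θ̃_*P_δ on path
space with ⟨Σ_t⟩ = σt + KL(μ_δ‖Θμ_δ) (smooth positive NESS density, Girsanov in the two noisy
momenta only), δ-continuity of Var_δ(Q_t), Gibbs-invariance of the constructed kernels and equal
mean bond currents (0717-level input).) [HasegawaVanVu2019, VanVuHasegawa2019, DechantSasa2020,
ReyBelletThomas2002AHP, EckmannPilletReyBellet1999b, KunduDharNarayan2009,
book:gaspard2022-statistical-mechanics-irreversible-phenomena p.389 (5.114),
CuneoEckmannHairerReyBellet2018]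
#9 LightConeBondHeat (support) — (S_lc) the light-cone special case of (S) (card U2 fallback / U4):
same objects, window 1 ≤ t ≤ a·N only — inside the cone t ≤ N/(2v) a bulk bond of the open chain
does not feel the baths (thermal Lieb–Robinson / finite-speed bounds for quartic chains,
ButtaEtAl2007), so this is the √t law of the INFINITE equilibrium chain transported to the open one.
Literally implied by SubdiffusiveBondHeat (take N ≥ a/c); filed separately because with (K) and (★)
it alone gives G_N → 0 (TransferToNonBallistic). The cheapest N-uniform statement of the line.
[difficulty: XL] [ButtaEtAl2007, MendlSpohn2015, Spohn2014, doi:10.1023/a:1014577928229]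
#9 TransferToBoundedResponse (support) — GLUE, PROVED sorry-free in the planner folder (Sketch.lean,
theorem transferToBoundedResponse_holds, axioms propext/Classical.choice/Quot.sound; ~110 lines of
real arithmetic, copy into Theorems/): SubdiffusiveBondHeat → ExtensiveSnapshotIrreversibility →
LinearResponseFTUR → NessUnique → BoundedResponse (hypothesis order chosen so that the gate renders
this item after the decls it mentions). Proof: at N ≥ max(N₀, 2, ⌈1/c⌉) take the bond of (S), t =
cN² (≥ 1), K = max(C,0)·N; since G_N ≥ 0 and K ≥ 0 the factor G_Nt/T² + K is ≥ 0, so V may be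
replaced by its bound max(A,0)√c·N WITHOUT any sign information on V; with x = N·G_N this reads
2c²x² ≤ Px + Q, hence x ≤ max(1,(P+Q)/(2c²)) and 0 ≤ D_N ≤ N·G_N; finitely many small N are
absorbed. Mesh test of the typed quantifiers: passed. [difficulty: provable-now]
[BonettoLebowitzReyBellet2000, HasegawaVanVu2019]
#9 TransferToNonBallistic (support) — GLUE for the qualitative rung, PROVED sorry-free in the
planner folder (theorem transferToNonBallistic_holds): LightConeBondHeat →
ExtensiveSnapshotIrreversibility → LinearResponseFTUR → NessUnique → NonBallistic. Proof: at t = aN,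
with r = √N, (★) gives 2a²rG² ≤ PG + Q; if G_N > ε then 2a²εr < P + Q/ε, i.e. N < ((P +
Q/ε)/(2a²ε))², so beyond that length D_N ≤ ε(N−1). Quantitatively G_N ≤ c₁N^(−1/2) + c₂N^(−1/4), D_N
= O(N^(3/4)): sub-ballistic transport from light-cone equilibrium data + data processing alone.
[difficulty: provable-now] [BonettoLebowitzReyBellet2000, HasegawaVanVu2019]
#9 BoundedResponse (support) — SHARED WAYPOINT (identical signature to FeketeResistance's crux
stmt-AtomisticToContinuum-2187; support in LocalOhmRigidity, TwoChannelDephasing):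
Literature.Barriers.AtomisticToContinuum.HasBoundedResponse (pinnedChain ω₂ lam β γ) for all
parameters > 0 — |D_N| bounded in N along every steady-state family. In THIS route it is an OUTPUT
(TransferToBoundedResponse), not a hypothesis of the Assembly: a prover holding (★), (S), (K) and
NessUnique closes 2187 for every route wanting it. [difficulty: open-problem]
[BonettoLebowitzReyBellet2000, Literature.Barriers.AtomisticToContinuum.HasBoundedResponse]
#9 NonBallistic (support) — SHARED (identical signature to SuperadditiveJunction's crux
stmt-AtomisticToContinuum-2192): under weak-NESS uniqueness, for every steady-state family, T > 0
and response coefficients D: ∀ ε > 0 there are arbitrarily long chains with D_N ≤ ε(N−1) (the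
conductance is not bounded away from 0). In THIS route it is the OUTPUT of the light-cone rung
(TransferToNonBallistic), not used by the Assembly. [difficulty: XL] [BonettoLebowitzReyBellet2000,
Mazur1969]
#9 NessUnique (support) — SHARED (stmt-AtomisticToContinuum-0741, identical signature): uniqueness
of the weak steady state (IsSteadyState class) of pinnedChain ω₂ lam β γ (all > 0) for every N, T_L,
T_R > 0. Hypothesis of (K), (★) and the transfers; with the PROVED fact
CuneoEckmannHairerReyBellet2018_pinnedChain it gives clause (i). [difficulty: L]
[CuneoEckmannHairerReyBellet2018, Carmona2007]
#9 FiniteResponseOfUnique (support) — SHARED (stmt-AtomisticToContinuum-0717, identical signature):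
under weak-NESS uniqueness the finite-N response limits D_N(T) exist for every steady-state family,
T > 0, N. Needed by the Assembly to produce D at all (the cruxes are vacuous along families without
response limits). [difficulty: L] [ReyBellet2003, HairerMajda2009, CuneoEckmannHairerReyBellet2018]
#9 PositiveOrInfiniteLimit (support) — IMPORT SLOT (what this line does NOT supply: a lower bound
and existence of the limit). Under weak-NESS uniqueness, for every steady-state family, T > 0 and
response coefficients D: D_N converges in EReal to some ℓ ∈ (0, +∞]. NECESSARY for the conjunct (D_N
→ κ(T) > 0), so not too strong; together with BoundedResponse it gives D_N → κ ∈ (0,∞). Suppliers: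
FeketeResistance minus its crux (B) (QuasiSubadditiveResistance + PositiveConductance + Fekete on {N
≥ 2} give R_N/N → ℓ' ∈ [0,∞), i.e. D_N → 1/ℓ' ∈ (0,+∞]); SuperadditiveJunction ((A)+(B)+(C) ⇒ real
positive limit); EscapeDeficit's bracket + EscapeNonOscillation. Dedup by signature will not catch
those — the tenure planner re-points the Assembly when one lands. Provers of THIS route should not
start here. [difficulty: L] [BonettoLebowitzReyBellet2000, Hammersley1988,
CanestrariLiveraniOlla2026]

TWO-LAYER PLAN. Foreseen glued splits (k ≤ 3, depth 1; nothing filed now): SubdiffusiveBondHeat ⇐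
InfiniteChainEW (√t law of the single-bond heat of the infinite equilibrium chain, first absolute
moment of energy spreading) → OpenVsInfinite (thermal Lieb–Robinson comparison for t ≤ N/2v,
ButtaEtAl2007) → BathWindow (extension to the Thouless window: bath-injected heat crossing a bulk
bond has variance controlled by half-chain energy fluctuations + far-bath heat) → S.
ExtensiveSnapshotIrreversibility ⇐ KLExpansion (fixed N: KL(μ_δ‖Θμ_δ) = 2δ²‖h^odd‖² + o(δ²)) →
OddCorrectorLocality (‖h_N^odd‖² ≤ CN from locality of the odd linear response) → K.
LinearResponseFTUR ⇐ EntropyBalance (Σ_t = log dP/dΘ̃_*P exists, ⟨Σ_t⟩ = σt + KL) → HVVAndContinuity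
(joint fluctuation theorem ⇒ Hasegawa–Van Vu; Var_δ → V_N; σ_δ/δ² → G_N/T²) → (★).

KILL CRITERIA. (a) ¬LinearResponseFTUR at some fixed N (an exact computation or theorem violating
(★), or ⟨Σ_t⟩ ≠ σt + KL(μ‖Θμ) for these thermostats) closes the route outright (close --reason
refuted:LinearResponseFTUR): the engine would be wrong; the exact Gaussian check on the harmonic
member passed (Numbers). (b) ¬SubdiffusiveBondHeat (equilibrium MD or a theorem showing V_N(b,cN²) ≫
N for every c, e.g. superdiffusive single-bond heat in the pinned chain): pivot to the light-cone
rung — the route survives as the NonBallistic engine (TransferToNonBallistic) or closes if even V =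
o(t) fails inside the cone. (c) ¬ExtensiveSnapshotIrreversibility with K_N ~ N^k: k ≤ 1 is needed
for bounded response, 1 < k < 3 still gives G_N → 0 through the Thouless window, k < 3/2 through the
light cone — restate (K) accordingly or close if k ≥ 3. (d) A hidden conserved quantity (Mazur)
refutes (S), NonBallistic and the conjunct together — file ¬FouriersLaw. (e) BoundedResponse proved
elsewhere moots the strong half (close --reason superseded, keep the NonBallistic rung if still
wanted).

NOT DECOMPOSED YET. The engines inside (S) (infinite-chain EW law, Lieb–Robinson comparison, bath
window), the fixed-N lemmas inside (★) (Girsanov density in the two noisy momenta, entropy balance,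
δ-continuity, kernel/Gibbs invariance = EscapeDeficit's BoundaryKernelBasics(a)), the KL expansion
and the locality engine inside (K); T-dependence of A, c, C, B; the identification K_N = 2‖h^odd‖²
(not needed by any statement); the CONTACT-heat version of (★) (boundary arena, no bulk bond); the
suppliers of PositiveOrInfiniteLimit (other routes). All are layer-2 children after a crux moves
(D-0019).

CHEAPEST FALSIFIER. Exact Gaussian linear algebra on the pinned HARMONIC member pinnedChain ω₂ 0 0
γ, where (★) and (K) must still hold and (S) must fail — RUN by this planner (folder
ftur_harmonic_check.py, pure Python < 40 s; Lyapunov equation for the NESS covariance, Isserlis for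
C_b(s), ω₂ = γ = T = 1, N = 2, 3, 4, 6): (★) holds for every bond and every t ∈ (0, 300] with min
RHS/LHS = 1.003, 1.011, 1.017, 1.034, decreasing to 1 as t → ∞ (tight, as predicted); ∫_0^∞ C_b ds =
T²G_N to 5 digits for EVERY bond (0.166678 vs 0.166667, …: the KDN normalisation behind the
saturation); K_N = 0.222, 0.339, 0.469, 0.781 ≈ 0.16·N (extensive: (K) holds at the ballistic
corner); G_N → 1/8 (ballistic, so (S) fails there, V ∝ t). Next cheapest, for a refuter with kit:
the same computation for N ≤ 200 (K_N/N → const? any bond/time where RHS/LHS < 1?) and equilibrium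
MD of V_N(b,t) for pinnedChain 1 1 1 1, N = 32…256, t ≤ N² (does V ≤ A√t persist to the Thouless
time; where does it cross over to 2T²G_N t?).

NUMBERS. Harmonic calibration (ω₂ = γ = T = 1, lam = β = 0; this planner's exact computation): G_2 =
1/6, G_3 = 0.13636, G_4 = 0.12791, G_6 = 0.12518 → fluxLimit 1/8; K_2 = 2/9, K_3 = 0.33884, K_4 =
0.46944, K_6 = 0.78087; ⟨j_b²⟩_T ∈ [0.278, 0.333] and the small-t consistency 2G_N²/⟨j_b²⟩ ≤ K_N
holds (0.167 ≤ 0.222, 0.119 ≤ 0.339, …); min_t RHS/LHS of (★) = 1.0028 (N = 2), 1.0105 (3), 1.0172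
(4), 1.0340 (6). Transfer constants: with V_N(b,cN²) ≤ A√c·N and K_N ≤ CN, N·G_N ≤ max(1, (A√c·c/T²
+ A√c·C)/(2c²)) (TransferToBoundedResponse); with the light cone t = aN, G_N ≤ c₁N^(−1/2) +
c₂N^(−1/4) (D_N = O(N^(3/4))). Tolerances: K_N ~ N^k keeps bounded response iff k ≤ 1, keeps G_N → 0
for k < 3 (Thouless window) / k < 3/2 (light cone). Expected diffusive values: V_N(b,t) ≈ A√t with A
∝ χ√D_th (χ = c_vT² energy susceptibility, D_th = κ/c_v), crossover to 2T²G_N t ≈ 2T²κt/N at t ≍ N²;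
kinetic phenomenology K_N = O(1) (even O(1/N) for the local part), far below CN. Items at open: 12
(3 cruxes, 8 support, 1 assembly) + the proved deciding theorem `closes`.

DEFINITION REQUESTS. None needed now: every object is typed over existing declarations
(OscillatorChain.transitionKernel, OscillatorChain.gibbsMeasure,
OscillatorChain.bondCurrent/totalCurrent/IsSteadyState, InformationTheory.klDiv,
MeasureTheory.Measure.map, Literature.Barriers.AtomisticToContinuum.HasBoundedResponse). Worth a
shared Literature definition later if the sibling cards are routed: `bondHeatVariance P N T b t :=
2∫_0^t (t−s)C_N(b,s)ds` (also used by ew-quarter-law-bond-current,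
dc-kirchhoff-flat-bond-conductivity) and `snapshotIrreversibility`
(static-irreversibility-loschmidt-echo). No cite facts requested: the fixed-N fluctuation theorem
(ReyBelletThomas2002AHP) is re-derived inside (★) rather than imported as a named fact, because the
printed statement concerns a different reservoir model.

Novelty: Searches (2026-08-15, this planner, on top of the card's searches and its refuter novelty audit):
`lit frontier AtomisticToContinuum --since 2020` (30 rows; none on TUR/FTUR; arXiv:2602.07988
"Hierarchical Lorentz mirror model … universal 2/3 mean–variance" is a mean–variance LAW for a toy
model, not an inequality route to size scaling); `lit bridges AtomisticToContinuum --cross any` (30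
rows, none relevant); `lit search --hybrid --source local "thermodynamic uncertainty relation
entropy production current fluctuations underdamped"` (12 books; read
book:gaspard2022-statistical-mechanics-irreversible-phenomena pp. 389–390: §5.4.4 eq. (5.114)
long-time TUR σ ≥ J²/D, which saturates at linear response — confirms that only a FINITE-time
relation can carry information here); `lit search --source crossref "thermodynamic uncertainty
relation thermal conductivity size dependence"` (8 hits, nanoscale phonon engineering, 0 relevant);
`--source zbmath "thermodynamic uncertainty relation heat conduction"` (2 textbooks); `lit galaxy
search "thermodynamic uncertainty relation" --star all` (panama/pdf queues timed out twice, crabby 1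
irrelevant) and `--star pdf "uncertainty relation"` (10, none on transport); openalex / arxiv / s2
cascades answered HTTP 429 all session (recorded, not worked around); crossref look-ups of the SSEP
sources (doi:10.1023/a:1014577928229 found). Grep of all 16 FouriersLaw route files for
TUR/klDiv/snapshot/Cramér: no route uses an information inequality.
Nearest  [refs: 10.1023/a:1014577928229, 10.1103/physreve.100.032130:, 2602.07988, 1902.06376, 1901.05715, 0809.4543, 1412.4609, book:gaspard2022-statistical-mechanics-irreversible-phenomena, doi:10.1023/a, doi:10.1103/physreve.100.032130, HasegawaVanVu2019, VanVuHasegawa2019, DechantSasa2020, KunduDharNarayan2009, MendlSpohn2015]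

Barriers (technique_class: information-inequality-ftur snapshot-irreversibility): - technique_class: information-inequality-ftur snapshot-irreversibility
- Literature.Barriers.AtomisticToContinuum.HasBoundedResponse: met head-on as an OUTPUT
(TransferToBoundedResponse, proved): the N-uniformity is relocated into two named inputs, (S)
(equilibrium, dynamical, first absolute moment, diffusive time scale) and (K) (static, NESS),
neither a fixed-N statement; only (★) is fixed-N, and it is N-uniform by construction (constant 2,
no hidden C_N) — fixed-N technology is used exactly where it is legitimate.
- Literature.Barriers.AtomisticToContinuum.HarmonicChainBallisticFlux: consistent and used as
calibration — at lam = β = 0, (★) and (K) hold (exact check, K_N ≈ 0.16N) while (S) fails (∫C_b =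
T²G_N = O(1), V ∝ t from t = O(1)), so the line cannot certify bounded response where it is false
(not_hasBoundedResponse).
- Literature.Barriers.AtomisticToContinuum.Mazur1969_inequality: a conserved charge overlapping the
current makes V_N(b,t) ≍ t and falsifies (S)/(S_lc), never (★); the line is silent, not wrong, on
ballistic members, and a Mazur witness for lam, β > 0 would refute the conjunct itself.
- Literature.Barriers.AtomisticToContinuum.BeckerMenegaki2022_gapClosing: no spectral gap,
relaxation rate or hypocoercive constant enters (★) or the transfers; a proof of (K) via ‖h‖ ≤
‖ρ_src‖/gap is explicitly excluded (gap ≲ γ/N) — (K) must come from locality of the odd response.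
- Literature.Barriers.AtomisticToContinuum.equilibrium_rate_bound: same class; (S) is a win

Novelty grade: new-combination — ROUTE REVIEW gen 4 (refuter rreview-0815T13-13-g4-0, 2026-08-15) — KEEP OPEN; fifth concurring pass (after g40-0, g41-24/35/10, rreview 13-9-0, g2, g3): the route is SATURATED with refuter review — recommend no further refuter passes until a crux moves or kit job j001286 reports. Today: 12/12 live d (refuter refuter-rreview-0815T13-13-g4-0, 2026-08-15T15:48:41Z; prior: HasegawaVanVu2019 arXiv:1902.06376; VanVuHasegawa2019 arXiv:1901.05715; DechantSasa2020, KunduDharNarayan2009 arXiv:0809.4543, MendlSpohn2015 arXiv:1412.4609 §4; Spohn2014; doi:10.1023/a:1014577928229, book:gaspard2022-statistical-mechanics-irreversible-phenomena p.389 (5.114), EckmannPilletReyBellet1999b; ReyBelletThomas2002AHP; CuneoEckmannHairerReyBellet2018)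

History (route lifecycle, newest last):
- 2026-08-15T14:08:07Z · rev 2: restated TransferToBoundedResponse (stmt-AtomisticToContinuum-9124), TransferToNonBallistic (stmt-AtomisticToContinuum-9125), Assembly (stmt-AtomisticToContinuum-9129) — render-order repair + D-0027 §2.1 deciding theorem: restate TransferToBoundedResponse / TransferToNonBallistic / Assembly with reordered hypoth (planner-plancard-AtomisticToContinuum-Fourier-5735f19b-0)
- 2026-08-15T16:38:01Z · rev 5: restated BoundedResponse (stmt-AtomisticToContinuum-9126) — route-repair (cone, gen 2): restate BoundedResponse 1:1 with the definiens of Literature.Barriers.AtomisticToContinuum.HasBoundedResponse written out (definitio (planner-rrepair-AtomisticToContinuum-BondHeatU-d5aca795-g2-0)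
- 2026-08-25T16:18:05Z · DORMANT — reconciler: no traction for 7.8 d (last activity item-evidence-added at 2026-08-17T19:19:10Z); parked, not closed — `ledger route dormant route-AtomisticToConti (operator:999:3385253)

sub-problem: FouriersLaw · status: dormant · opened planner-plancard-AtomisticToContinuum-Fourier-5735f19b-0 2026-08-15T13:49:34Z · rev 6 · ledger route-AtomisticToContinuum-BondHeatUncertainty
GENERATED by the gate from the ledger (D-0016/17). Provers cite these decls: `theorem foo : Summit.AtomisticToContinuum.FouriersLaw.Theses.BondHeatUncertainty.<Decl> := …` in Summits/AtomisticToContinuum/FouriersLaw/Theorems/<Name>.lean.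
-/

namespace Summit.AtomisticToContinuum.FouriersLaw.Theses.BondHeatUncertainty

open scoped BigOperators Topology Manifold Classical MeasureTheory ProbabilityTheory Matrix InnerProductSpace ComplexConjugate ContinuousMap
open Filter Set Function TopologicalSpace MeasureTheory

attribute [summit_statement] _root_.FouriersLaw

/-- item stmt-AtomisticToContinuum-9120 · crux · rank 2 · open · by planner
why it might fail: N-uniform EW ¼-law V_N(b,t) ≤ A√t up to the Thouless time cN² for a DETERMINISTIC anharmonic bulk — no rigorous diffusive estimate exists for such chains (BLR2000 §6.3; only noisy bulks, BernardinOlla2005); false if equilibrium energy spreading is superdiffusive (C_b(s) ~ −s^(−α), α < 3/2).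
sources: MendlSpohn2015, BonettoLebowitzReyBellet2000, doi:10.1023/a:1014577928229, arXiv:0711.0017, AokiLukkarinenSpohn2006, BernardinOlla2005
[crux] (S) card item U2. For P = pinnedChain ω₂ lam β γ (all > 0) and T > 0, with C_N(b,s) = ∫ j_b ·
(P_s j_b) dμ_T^N (constructed transitionKernel at equal bath temperatures T, gibbsMeasure) and
V_N(b,t) = 2∫_0^t (t−s)C_N(b,s)ds the equilibrium variance of the heat Q_t^(b) through bond (b,b+1):
∃ A, c > 0, N₀ such that every N ≥ N₀ has a bond b (b+1 < N; the prover picks it, e.g. the middle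
bond) with V_N(b,t) ≤ A√t for all 1 ≤ t ≤ cN². Reading: by conservation V = 2Σ_z|z|[S(z,0) − S(z,t)]
+ boundary terms (MendlSpohn2015 §4 (4.6)), so this bounds the FIRST ABSOLUTE MOMENT of equilibrium
energy spreading by √t up to the Thouless time — implied by (Cauchy–Schwarz), and strictly weaker
than, a diffusive second-moment / Green–Kubo bound; it asks nothing about convergence of ∫C_J or κ =
κ_GK. Model case: √t (fBM-¼) bond-current fluctuations of SSEP (De Masi–Ferrari;
Peligrad–Sethuraman). Only the value t = cN² is consumed by the transfer; the window form is the
natural statement and contains LightConeBondHeat. [difficulty: XL] -/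
@[route_item "route-AtomisticToContinuum-BondHeatUncertainty", crux]
def SubdiffusiveBondHeat : Prop :=
  ∀ ω₂ lam β γ : ℝ, 0 < ω₂ → 0 < lam → 0 < β → 0 < γ → ∀ T : ℝ, 0 < T → (let P := Literature.MathematicalPhysics.KineticTheory.HeatConduction.pinnedChain ω₂ lam β γ; let C : ℕ → ℕ → ℝ → ℝ := fun N b s => if h : b < N then ∫ z, P.bondCurrent N ⟨b, h⟩ z * (∫ y, P.bondCurrent N ⟨b, h⟩ y ∂(P.transitionKernel N T T s.toNNReal z)) ∂(P.gibbsMeasure N T) else 0; let V : ℕ → ℕ → ℝ → ℝ := fun N b t => 2 * ∫ s in (0 : ℝ)..t, (t - s) * C N b s; ∃ A c : ℝ, 0 < c ∧ ∃ N₀ : ℕ, ∀ N : ℕ, N₀ ≤ N → ∃ b : ℕ, b + 1 < N ∧ ∀ t : ℝ, 1 ≤ t → t ≤ c * (N : ℝ) ^ 2 → V N b t ≤ A * Real.sqrt t)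

/-- item stmt-AtomisticToContinuum-9121 · crux · rank 3 · open · by planner
why it might fail: No N-uniform control of K_N = limsup δ⁻²KL = 2‖h_N^odd‖² except gap/resolvent bounds that degrade with N (gap ≲ γ/N; N⁻³ harmonic, BeckerMenegaki2022); long-range odd NESS correlations could force K_N ~ N^k, k > 1; at fixed N even KL(μ_δ‖Θμ_δ) < ∞ needs two-sided NESS density bounds not in print.
sources: VanVuHasegawa2019, BeckerMenegaki2022, EckmannPilletReyBellet1999b, CuneoEckmannHairerReyBellet2018, MaesNetocny2010, RiederLebowitzLieb1967
[crux] (K) card item U3. Under weak-NESS uniqueness, for every steady-state family μ of pinnedChain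
ω₂ lam β γ (all > 0) and T > 0: ∃ C such that for every N, eventually as δ → 0 (δ ≠ 0),
KL(μ_{N,T+δ/2,T−δ/2} ‖ Θ_*μ_{N,T+δ/2,T−δ/2}) ≤ C·N·δ², Θ(q,p) = (q,−p) (Mathlib
InformationTheory.klDiv, Measure.map). Reading: K_N := limsup δ⁻²KL = 2‖h_N^odd‖²_{L²(μ_T)}, h^odd =
½∫_0^∞(P_s − P_s^*)ρ_src ds the odd part of the linear-response density — 'how much of the arrow of
time is visible in one snapshot of the steady state'. Extensive is generous: kinetic/diffusive
phenomenology gives K_N = O(1) (local odd corrections O(δ/N) per site plus long-range pair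
correlations O(δ/N)), and the BALLISTIC harmonic chain has K_N ≈ 0.16·N (exact Gaussian computation,
Numbers) — all the diffusive input of the line sits in (S). N = 0, 1: KL = 0. Expected engine:
locality of the odd response (odd corrector = gradient × cell correctors), NOT ‖h‖ ≤ ‖ρ_src‖/gap.
[difficulty: L] -/
@[route_item "route-AtomisticToContinuum-BondHeatUncertainty", crux]
def ExtensiveSnapshotIrreversibility : Prop :=
  ∀ ω₂ lam β γ : ℝ, 0 < ω₂ → 0 < lam → 0 < β → 0 < γ → (∀ (N : ℕ) (T_L T_R : ℝ), 0 < T_L → 0 < T_R → ∀ μ ν : MeasureTheory.Measure (Literature.MathematicalPhysics.KineticTheory.HeatConduction.PhaseSpace N), (Literature.MathematicalPhysics.KineticTheory.HeatConduction.pinnedChain ω₂ lam β γ).IsSteadyState N T_L T_R μ → (Literature.MathematicalPhysics.KineticTheory.HeatConduction.pinnedChain ω₂ lam β γ).IsSteadyState N T_L T_R ν → μ = ν) → ∀ μ : (N : ℕ) → ℝ → ℝ → MeasureTheory.Measure (Literature.MathematicalPhysics.KineticTheory.HeatConduction.PhaseSpace N), (∀ (N : ℕ) (T_L T_R : ℝ),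 0 < T_L → 0 < T_R → (Literature.MathematicalPhysics.KineticTheory.HeatConduction.pinnedChain ω₂ lam β γ).IsSteadyState N T_L T_R (μ N T_L T_R)) → ∀ T : ℝ, 0 < T → ∃ C : ℝ, ∀ N : ℕ, ∀ᶠ δ in nhdsWithin (0 : ℝ) {(0 : ℝ)}ᶜ, InformationTheory.klDiv (μ N (T + δ / 2) (T - δ / 2)) (MeasureTheory.Measure.map (fun x : Literature.MathematicalPhysics.KineticTheory.HeatConduction.PhaseSpace N => (x.1, -x.2)) (μ N (T + δ / 2) (T - δ / 2))) ≤ ENNReal.ofReal (C * (N : ℝ) * δ ^ 2)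

/-- item stmt-AtomisticToContinuum-9122 · crux · rank 4 · closed · proved by Summit.AtomisticToContinuum.FouriersLaw.Theorems.LinearResponseFTUR_proof (prover) · by planner
why it might fail: Tight as t→∞ (finite-N Kubo saturation, ReyBellet2006 Thm 4.1(c)/KDN2009): any slip in the fixed-N bookkeeping falsifies it — P_δ ~ Θ̃_*P_δ with EΣ_t = σ_δt + KL(μ_δ‖Θμ_δ) (true-martingale Girsanov, cubic drift, Novikov fails), Var_δ(Q_t) → V_N (Gibbs-invariance, δ-continuity), equal bond currents.
sources: HasegawaVanVu2019, VanVuHasegawa2019, ReyBellet2006, MaesNetocnyVerschuere2003, EckmannPilletReyBellet1999b, ReyBelletThomas2002AHP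
[crux] (★) card item U1, the engine, FIXED N. Under weak-NESS uniqueness, for every steady-state
family μ, T > 0 and response coefficients D (the δ-limits of clause (ii)): for every N ≥ 2, (a) D_N
≥ 0 (entropy production ⟨Σ_t⟩ = σt + KL ≥ 0 for all t forces σ = G_Nδ²/T² + o(δ²) ≥ 0), and (b) for
every bond b, every t > 0 and every K ≥ 0 with KL(μ_{N,δ}‖Θ_*μ_{N,δ}) ≤ Kδ² eventually: 2G_N²t² ≤
V_N(b,t)·(G_N t/T² + K), G_N = D_N/(N−1), V_N as in (S). Derivation (checked by a refuter audit and,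
numerically, on the harmonic chain — Numbers): Σ_t := log dP_δ^[0,t]/dΘ̃_*P_δ^[0,t] (Θ̃ = time
reversal ∘ momentum flip of the stationary path measure) satisfies the joint detailed fluctuation
theorem with the Θ̃-odd Q_t^(b), hence Hasegawa–Van Vu: ⟨Q_t⟩² ≤ ½Var_δ(Q_t)(e^{⟨Σ_t⟩} − 1) at every
δ; ⟨Q_t⟩ = G_Nδt(1+o(1)) (equal mean bond currents), ⟨Σ_t⟩ = σ_δ t + KL(μ_δ‖Θ_*μ_δ) with σ_δ =
J_δ(1/T_R − 1/T_L) (EckmannPilletReyBellet1999b; ReyBelletThomas2002AHP), Var_δ(Q_t) → V_N(b,t) as δ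
→ 0 (Gibbs invariance + Markov property of the constructed kernels: Var_eq(∫_0^t j_b) =
2∫_0^t(t−s)C_N(b,s)ds since μ_T(j_b) = 0); divide by δ² and let δ → 0. Saturates as t → ∞ (V ~
2T²G_N t, KunduDharNarayan2009: -/
@[route_item "route-AtomisticToContinuum-BondHeatUncertainty", crux]
def LinearResponseFTUR : Prop :=
  ∀ ω₂ lam β γ : ℝ, 0 < ω₂ → 0 < lam → 0 < β → 0 < γ → (∀ (N : ℕ) (T_L T_R : ℝ), 0 < T_L → 0 < T_R → ∀ μ ν : MeasureTheory.Measure (Literature.MathematicalPhysics.KineticTheory.HeatConduction.PhaseSpace N), (Literature.MathematicalPhysics.KineticTheory.HeatConduction.pinnedChain ω₂ lam β γ).IsSteadyState N T_L T_R μ → (Literature.MathematicalPhysics.KineticTheory.HeatConduction.pinnedChain ω₂ lam β γ).IsSteadyState N T_L T_R ν → μ = ν) → ∀ μ : (N : ℕ) → ℝ → ℝ → MeasureTheory.Measure (Literature.MathematicalPhysics.KineticTheory.HeatConduction.PhaseSpace N), (∀ (N : ℕ) (T_L T_R : ℝ), 0 < T_L → 0 < T_R → (Literature.MathematicalPhysics.KineticTheory.HeatConduction.pinnedChain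 ω₂ lam β γ).IsSteadyState N T_L T_R (μ N T_L T_R)) → ∀ T : ℝ, 0 < T → ∀ D : ℕ → ℝ, (∀ N : ℕ, Filter.Tendsto (fun δ : ℝ => (Literature.MathematicalPhysics.KineticTheory.HeatConduction.pinnedChain ω₂ lam β γ).totalCurrent (μ N (T + δ / 2) (T - δ / 2)) / δ) (nhdsWithin 0 {(0 : ℝ)}ᶜ) (nhds (D N))) → (let P := Literature.MathematicalPhysics.KineticTheory.HeatConduction.pinnedChain ω₂ lam β γ; let C : ℕ → ℕ → ℝ → ℝ := fun N b s => if h : b < N then ∫ z, P.bondCurrent N ⟨b, h⟩ z * (∫ y, P.bondCurrent N ⟨b, h⟩ y ∂(P.transitionKernel N T T s.toNNReal z)) ∂(P.gibbsMeasure N T) else 0; let V : ℕ → ℕ → ℝ → ℝ := fun N b t => 2 * ∫ s in (0 : ℝ)..t, (t - s) * C N b s; ∀ N : ℕ, 2 ≤ N → 0 ≤ D N ∧ ∀ b : ℕ, b + 1 < N → ∀ t : ℝ, 0 < t → ∀ K : ℝ, 0 ≤ K → (∀ᶠ δ in nhdsWithin (0 : ℝ) {(0 : ℝ)}ᶜ,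 InformationTheory.klDiv (μ N (T + δ / 2) (T - δ / 2)) (MeasureTheory.Measure.map (fun x : Literature.MathematicalPhysics.KineticTheory.HeatConduction.PhaseSpace N => (x.1, -x.2)) (μ N (T + δ / 2) (T - δ / 2))) ≤ ENNReal.ofReal (K * δ ^ 2)) → 2 * (D N / ((N : ℝ) - 1)) ^ 2 * t ^ 2 ≤ V N b t * (D N / ((N : ℝ) - 1) * t / T ^ 2 + K))

/-- item stmt-AtomisticToContinuum-0717 · support · rank 9 · closed · proved by Summit.AtomisticToContinuum.FouriersLaw.Theorems.FourierGreenKubo.finiteResponseOfUnique_holds (prover) · by planner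
sources: ReyBellet2003, HairerMajda2009, CuneoEckmannHairerReyBellet2018
CONDITIONAL FORM OF 0705 (supersedes it as the prover target; refuters pool-5/g3-0: 0705 stand-alone
quantifies over EVERY steady-state family and is false-prone if weak steady states were non-unique):
assuming UNIQUENESS of weak steady states (IsSteadyState class) for pinnedChain at all N, T_L, T_R >
0, the finite-N linear-response limit D_N(T) = lim_{δ→0, δ≠0} totalCurrent(μ_{N,T+δ/2,T−δ/2})/δ
exists for every T > 0 and N. Content: differentiability at equilibrium of NESS expectations of the
polynomial currents in the bath temperatures (ReyBellet2003 arXiv:math-ph/0303021 Rem 4.4 (51)–(56)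
finite-volume Green–Kubo; HairerMajda2009 arXiv:0909.4313 Thm 2.3 framework — their SDE Thm 4.4
Assumption 5 fails here, so verify Assumptions 1–3 via CEHR2018 (2.5)/Carmona2007 Thm 1.1(iv)
weighted spectral gap). N = 0, 1: totalCurrent ≡ 0, D = 0. Together with 0706 gives 0705. -/
@[route_item "route-AtomisticToContinuum-BondHeatUncertainty", crux]
def FiniteResponseOfUnique : Prop :=
  ∀ ω₂ lam β γ : ℝ, 0 < ω₂ → 0 < lam → 0 < β → 0 < γ → (∀ (N : ℕ) (T_L T_R : ℝ), 0 < T_L → 0 < T_R → ∀ μ ν : MeasureTheory.Measure (Literature.MathematicalPhysics.KineticTheory.HeatConduction.PhaseSpace N), (Literature.MathematicalPhysics.KineticTheory.HeatConduction.pinnedChain ω₂ lam β γ).IsSteadyState N T_L T_R μ → (Literature.MathematicalPhysics.KineticTheory.HeatConduction.pinnedChain ω₂ lam β γ).IsSteadyState N T_L T_R ν → μ = ν) → ∀ μ : (N : ℕ) → ℝ → ℝ → MeasureTheory.Measure (Literature.MathematicalPhysics.KineticTheory.HeatConduction.PhaseSpace N), (∀ (N : ℕ) (T_L T_R : ℝ),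 0 < T_L → 0 < T_R → (Literature.MathematicalPhysics.KineticTheory.HeatConduction.pinnedChain ω₂ lam β γ).IsSteadyState N T_L T_R (μ N T_L T_R)) → ∀ T : ℝ, 0 < T → ∀ N : ℕ, ∃ D : ℝ, Filter.Tendsto (fun δ : ℝ => (Literature.MathematicalPhysics.KineticTheory.HeatConduction.pinnedChain ω₂ lam β γ).totalCurrent (μ N (T + δ / 2) (T - δ / 2)) / δ) (nhdsWithin 0 {(0 : ℝ)}ᶜ) (nhds D)

/-- item stmt-AtomisticToContinuum-0741 · support · rank 9 · closed · proved by Summit.AtomisticToContinuum.FouriersLaw.Theorems.nessUnique_proof (prover) · by planner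
sources: CuneoEckmannHairerReyBellet2018, Carmona2007
[crux] UNIQUENESS OF THE WEAK STEADY STATE (the half of stmt-0706 not covered by the landed fact
Literature.MathematicalPhysics.KineticTheory.HeatConduction.CuneoEckmannHairerReyBellet2018_pinnedChain,
p3544): for pinnedChain ω₂ lam β γ (all > 0), every N and T_L, T_R > 0, any two measures in the weak
Fokker–Planck class IsSteadyState (probability, ∫ L f dμ = 0 for f ∈ C_c^∞, bond currents
integrable) coincide. Print: uniqueness of the INVARIANT MEASURE of the Langevin semigroup
(CuneoEckmannHairerReyBellet2018 Thm 2.13(1): C1, C2, CA; Carmona2007 Thm 1.1(iii)); the item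
additionally needs 'weak stationary probability solution of L*μ = 0 ⇒ P_t-invariant' for this
hypoelliptic L with cubic drift (Echeverría 1982 well-posed martingale problem on C_c^∞ +
non-explosion via e^{θH}; Bogachev–Krylov–Röckner–Shaposhnikov 2015 Ch. 5 is non-degenerate only) —
the FP-identification lemma is the formal crux. N = 0: PhaseSpace 0 is a point (unique probability
measure); N = 1: both baths on site 0, OU at temperature (T_L+T_R)/2. This is exactly the hypothesis
of FiniteResponse and ThermodynamicLimit and, with the fact, gives clause (i) of FouriersLawFor. -/
@[route_item "route-AtomisticToContinuum-BondHeatUncertainty", crux]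
def NessUnique : Prop :=
  ∀ ω₂ lam β γ : ℝ, 0 < ω₂ → 0 < lam → 0 < β → 0 < γ → ∀ (N : ℕ) (T_L T_R : ℝ), 0 < T_L → 0 < T_R → ∀ μ ν : MeasureTheory.Measure (Literature.MathematicalPhysics.KineticTheory.HeatConduction.PhaseSpace N), (Literature.MathematicalPhysics.KineticTheory.HeatConduction.pinnedChain ω₂ lam β γ).IsSteadyState N T_L T_R μ → (Literature.MathematicalPhysics.KineticTheory.HeatConduction.pinnedChain ω₂ lam β γ).IsSteadyState N T_L T_R ν → μ = ν

-- earlier BoundedResponse (stmt-AtomisticToContinuum-9126, replaced 2026-08-15T16:38:01Z -> stmt-AtomisticToContinuum-11071): retired by None — ∀ ω₂ lam β γ : ℝ, 0 < ω₂ → 0 < lam → 0 < β → 0 < γ → Literature.Barriers.AtomisticToContinuum.HasBoundedResponse (Literature.MathematicalPhysics.KineticTheory.HeatConduction.pinnedChain ω₂ lam β γ)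
/-- item stmt-AtomisticToContinuum-11071 · support · rank 9 · open · by planner
sources: BonettoLebowitzReyBellet2000, Literature.Barriers.AtomisticToContinuum.hasBoundedResponse_iff
[support] SHARED-WAYPOINT CONTENT, WRITTEN OUT (=
`Literature.Barriers.AtomisticToContinuum.HasBoundedResponse (pinnedChain ω₂ lam β γ)` for all
parameters > 0 — definiens verbatim; `hasBoundedResponse_iff` is `Iff.rfl`, so the old and the new
decl are definitionally equal: planner SketchIff.lean `example : New = Old := rfl`, rc 0): along
EVERY steady-state family μ (IsSteadyState class, no uniqueness assumed) and every T > 0, if the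
finite-N response limits D_N = lim_{δ→0, δ≠0} totalCurrent(μ_{N,T+δ/2,T−δ/2})/δ exist for all N,
then (|D_N|)_N is bounded — BLR2000 §6.3's missing 'dependence of D on L' in its weakest
quantitative form. In THIS route it is an OUTPUT (TransferToBoundedResponse 9655, candidate proof
attached) consumed by `closes`; open-problem as a standalone target. Cone repair 2026-08-15
(route-repair gen 2): the Barriers PREDICATE carries [cite] doc tags and no `_holds` (it is
vocabulary, explicit binder P), so the staffability audit (#h21_route_deps, D-0027 §2.1 amended)
lists it as an unproved cite-only dependency (confirmed on sibling route OddSectorIrreversibility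
rev 2→3, now staffable); unfolding removes the name from the decl cone without changing the stateme -/
@[route_item "route-AtomisticToContinuum-BondHeatUncertainty", crux]
def BoundedResponse : Prop :=
  ∀ ω₂ lam β γ : ℝ, 0 < ω₂ → 0 < lam → 0 < β → 0 < γ → ∀ μ : (N : ℕ) → ℝ → ℝ → MeasureTheory.Measure (Literature.MathematicalPhysics.KineticTheory.HeatConduction.PhaseSpace N), (∀ (N : ℕ) (T_L T_R : ℝ), 0 < T_L → 0 < T_R → (Literature.MathematicalPhysics.KineticTheory.HeatConduction.pinnedChain ω₂ lam β γ).IsSteadyState N T_L T_R (μ N T_L T_R)) → ∀ T : ℝ, 0 < T → ∀ D : ℕ → ℝ, (∀ N : ℕ, Filter.Tendsto (fun δ : ℝ => (Literature.MathematicalPhysics.KineticTheory.HeatConduction.pinnedChain ω₂ lam β γ).totalCurrent (μ N (T + δ / 2) (T - δ / 2)) / δ) (nhdsWithin 0 {(0 : ℝ)}ᶜ) (nhds (D N))) → BddAbove (Set.range fun N => |D N|)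

/-- item stmt-AtomisticToContinuum-9123 · support · rank 9 · open · by planner
sources: ButtaEtAl2007, MendlSpohn2015, Spohn2014, doi:10.1023/a:1014577928229
[support] (S_lc) the light-cone special case of (S) (card U2 fallback / U4): same objects, window 1
≤ t ≤ a·N only — inside the cone t ≤ N/(2v) a bulk bond of the open chain does not feel the baths
(thermal Lieb–Robinson / finite-speed bounds for quartic chains, ButtaEtAl2007), so this is the √t
law of the INFINITE equilibrium chain transported to the open one. Literally implied by
SubdiffusiveBondHeat (take N ≥ a/c); filed separately because with (K) and (★) it alone gives G_N →
0 (TransferToNonBallistic). The cheapest N-uniform statement of the line. [difficulty: XL] -/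
@[route_item "route-AtomisticToContinuum-BondHeatUncertainty"]
def LightConeBondHeat : Prop :=
  ∀ ω₂ lam β γ : ℝ, 0 < ω₂ → 0 < lam → 0 < β → 0 < γ → ∀ T : ℝ, 0 < T → (let P := Literature.MathematicalPhysics.KineticTheory.HeatConduction.pinnedChain ω₂ lam β γ; let C : ℕ → ℕ → ℝ → ℝ := fun N b s => if h : b < N then ∫ z, P.bondCurrent N ⟨b, h⟩ z * (∫ y, P.bondCurrent N ⟨b, h⟩ y ∂(P.transitionKernel N T T s.toNNReal z)) ∂(P.gibbsMeasure N T) else 0; let V : ℕ → ℕ → ℝ → ℝ := fun N b t => 2 * ∫ s in (0 : ℝ)..t, (t - s) * C N b s; ∃ A a : ℝ, 0 < a ∧ ∃ N₀ : ℕ, ∀ N : ℕ, N₀ ≤ N → ∃ b : ℕ, b + 1 < N ∧ ∀ t : ℝ, 1 ≤ t → t ≤ a * (N : ℝ) → V N b t ≤ A * Real.sqrt t)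

/-- item stmt-AtomisticToContinuum-9127 · support · rank 9 · open · by planner
sources: BonettoLebowitzReyBellet2000, Mazur1969
[support] SHARED (identical signature to SuperadditiveJunction's crux
stmt-AtomisticToContinuum-2192): under weak-NESS uniqueness, for every steady-state family, T > 0
and response coefficients D: ∀ ε > 0 there are arbitrarily long chains with D_N ≤ ε(N−1) (the
conductance is not bounded away from 0). In THIS route it is the OUTPUT of the light-cone rung
(TransferToNonBallistic), not used by the Assembly. [difficulty: XL] -/
@[route_item "route-AtomisticToContinuum-BondHeatUncertainty"]
def NonBallistic : Prop :=
  ∀ ω₂ lam β γ : ℝ, 0 < ω₂ → 0 < lam → 0 < β → 0 < γ → (∀ (N : ℕ) (T_L T_R : ℝ), 0 < T_L → 0 < T_R → ∀ μ ν : MeasureTheory.Measure (Literature.MathematicalPhysics.KineticTheory.HeatConduction.PhaseSpace N), (Literature.MathematicalPhysics.KineticTheory.HeatConduction.pinnedChain ω₂ lam β γ).IsSteadyState N T_L T_R μ → (Literature.MathematicalPhysics.KineticTheory.HeatConduction.pinnedChain ω₂ lam β γ).IsSteadyState N T_L T_R ν → μ = ν) → ∀ μ : (N : ℕ) → ℝ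 → ℝ → MeasureTheory.Measure (Literature.MathematicalPhysics.KineticTheory.HeatConduction.PhaseSpace N), (∀ (N : ℕ) (T_L T_R : ℝ), 0 < T_L → 0 < T_R → (Literature.MathematicalPhysics.KineticTheory.HeatConduction.pinnedChain ω₂ lam β γ).IsSteadyState N T_L T_R (μ N T_L T_R)) → ∀ T : ℝ, 0 < T → ∀ D : ℕ → ℝ, (∀ N : ℕ, Filter.Tendsto (fun δ : ℝ => (Literature.MathematicalPhysics.KineticTheory.HeatConduction.pinnedChain ω₂ lam β γ).totalCurrent (μ N (T + δ / 2) (T - δ / 2)) / δ) (nhdsWithin 0 {(0 : ℝ)}ᶜ) (nhds (D N))) → ∀ ε : ℝ, 0 < ε → ∀ N₀ : ℕ, ∃ N : ℕ, N₀ ≤ N ∧ D N ≤ ε * ((N : ℝ) - 1)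

/-- item stmt-AtomisticToContinuum-9128 · support · rank 9 · open · by planner
sources: BonettoLebowitzReyBellet2000, Hammersley1988, CanestrariLiveraniOlla2026
[support] IMPORT SLOT (what this line does NOT supply: a lower bound and existence of the limit).
Under weak-NESS uniqueness, for every steady-state family, T > 0 and response coefficients D: D_N
converges in EReal to some ℓ ∈ (0, +∞]. NECESSARY for the conjunct (D_N → κ(T) > 0), so not too
strong; together with BoundedResponse it gives D_N → κ ∈ (0,∞). Suppliers: FeketeResistance minus
its crux (B) (QuasiSubadditiveResistance + PositiveConductance + Fekete on {N ≥ 2} give R_N/N → ℓ' ∈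
[0,∞), i.e. D_N → 1/ℓ' ∈ (0,+∞]); SuperadditiveJunction ((A)+(B)+(C) ⇒ real positive limit);
EscapeDeficit's bracket + EscapeNonOscillation. Dedup by signature will not catch those — the tenure
planner re-points the Assembly when one lands. Provers of THIS route should not start here.
[difficulty: L] -/
@[route_item "route-AtomisticToContinuum-BondHeatUncertainty", crux]
def PositiveOrInfiniteLimit : Prop :=
  ∀ ω₂ lam β γ : ℝ, 0 < ω₂ → 0 < lam → 0 < β → 0 < γ → (∀ (N : ℕ) (T_L T_R : ℝ), 0 < T_L → 0 < T_R → ∀ μ ν : MeasureTheory.Measure (Literature.MathematicalPhysics.KineticTheory.HeatConduction.PhaseSpace N), (Literature.MathematicalPhysics.KineticTheory.HeatConduction.pinnedChain ω₂ lam β γ).IsSteadyState N T_L T_R μ → (Literature.MathematicalPhysics.KineticTheory.HeatConduction.pinnedChain ω₂ lam β γ).IsSteadyState N T_L T_R ν → μ = ν) → ∀ μ : (N : ℕ) → ℝ → ℝ → MeasureTheory.Measure (Literature.MathematicalPhysics.KineticTheory.HeatConduction.PhaseSpace N), (∀ (N : ℕ) (T_L T_R : ℝ), 0 < T_L → 0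 < T_R → (Literature.MathematicalPhysics.KineticTheory.HeatConduction.pinnedChain ω₂ lam β γ).IsSteadyState N T_L T_R (μ N T_L T_R)) → ∀ T : ℝ, 0 < T → ∀ D : ℕ → ℝ, (∀ N : ℕ, Filter.Tendsto (fun δ : ℝ => (Literature.MathematicalPhysics.KineticTheory.HeatConduction.pinnedChain ω₂ lam β γ).totalCurrent (μ N (T + δ / 2) (T - δ / 2)) / δ) (nhdsWithin 0 {(0 : ℝ)}ᶜ) (nhds (D N))) → ∃ ℓ : EReal, 0 < ℓ ∧ Filter.Tendsto (fun N : ℕ => ((D N : ℝ) : EReal)) Filter.atTop (nhds ℓ)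

-- earlier TransferToBoundedResponse (stmt-AtomisticToContinuum-9124, replaced 2026-08-15T14:08:07Z -> stmt-AtomisticToContinuum-9655): retired by None — LinearResponseFTUR → SubdiffusiveBondHeat → ExtensiveSnapshotIrreversibility → NessUnique → BoundedResponse
/-- item stmt-AtomisticToContinuum-9655 · support · rank 9 · closed · proved by Summit.AtomisticToContinuum.FouriersLaw.Theorems.transferToBoundedResponse_proof @ f8de5f1a4f86 (prover) · by planner
sources: BonettoLebowitzReyBellet2000, HasegawaVanVu2019
[support] GLUE, PROVED sorry-free in the planner folder (Sketch.lean, theorem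
transferToBoundedResponse_holds, axioms propext/Classical.choice/Quot.sound; ~110 lines of real
arithmetic, copy into Theorems/): SubdiffusiveBondHeat → ExtensiveSnapshotIrreversibility →
LinearResponseFTUR → NessUnique → BoundedResponse (hypothesis order chosen so that the gate renders
this item after the decls it mentions). Proof: at N ≥ max(N₀, 2, ⌈1/c⌉) take the bond of (S), t =
cN² (≥ 1), K = max(C,0)·N; since G_N ≥ 0 and K ≥ 0 the factor G_Nt/T² + K is ≥ 0, so V may be
replaced by its bound max(A,0)√c·N WITHOUT any sign information on V; with x = N·G_N this reads
2c²x² ≤ Px + Q, hence x ≤ max(1,(P+Q)/(2c²)) and 0 ≤ D_N ≤ N·G_N; finitely many small N are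
absorbed. Mesh test of the typed quantifiers: passed. [difficulty: provable-now] -/
@[route_item "route-AtomisticToContinuum-BondHeatUncertainty", crux]
def TransferToBoundedResponse : Prop :=
  SubdiffusiveBondHeat → ExtensiveSnapshotIrreversibility → LinearResponseFTUR → NessUnique → BoundedResponse

-- earlier TransferToNonBallistic (stmt-AtomisticToContinuum-9125, replaced 2026-08-15T14:08:07Z -> stmt-AtomisticToContinuum-9656): retired by None — LinearResponseFTUR → LightConeBondHeat → ExtensiveSnapshotIrreversibility → NessUnique → NonBallistic
/-- item stmt-AtomisticToContinuum-9656 · support · rank 9 · closed · proved by Summit.AtomisticToContinuum.FouriersLaw.Theorems.transferToNonBallistic_proof @ 85a7f31cb3ec (prover) · by planner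
sources: BonettoLebowitzReyBellet2000, HasegawaVanVu2019
[support] GLUE for the qualitative rung, PROVED sorry-free in the planner folder (theorem
transferToNonBallistic_holds): LightConeBondHeat → ExtensiveSnapshotIrreversibility →
LinearResponseFTUR → NessUnique → NonBallistic. Proof: at t = aN, with r = √N, (★) gives 2a²rG² ≤ PG
+ Q; if G_N > ε then 2a²εr < P + Q/ε, i.e. N < ((P + Q/ε)/(2a²ε))², so beyond that length D_N ≤
ε(N−1). Quantitatively G_N ≤ c₁N^(−1/2) + c₂N^(−1/4), D_N = O(N^(3/4)): sub-ballistic transport from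
light-cone equilibrium data + data processing alone. [difficulty: provable-now] -/
@[route_item "route-AtomisticToContinuum-BondHeatUncertainty"]
def TransferToNonBallistic : Prop :=
  LightConeBondHeat → ExtensiveSnapshotIrreversibility → LinearResponseFTUR → NessUnique → NonBallistic

-- earlier Assembly (stmt-AtomisticToContinuum-9129, replaced 2026-08-15T14:08:07Z -> stmt-AtomisticToContinuum-9657): retired by None — TransferToBoundedResponse → LinearResponseFTUR → SubdiffusiveBondHeat → ExtensiveSnapshotIrreversibility → NessUnique → FiniteResponseOfUnique → PositiveOrInfiniteLimit → FouriersLaw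
/-- item stmt-AtomisticToContinuum-9657 · assembly · rank 1 · closed · proved by Summit.AtomisticToContinuum.FouriersLaw.Theorems.bondHeatUncertainty_assembly_proof @ 074fd9a481a7 (prover) · by planner
sources: BonettoLebowitzReyBellet2000, CuneoEckmannHairerReyBellet2018
[assembly] TransferToBoundedResponse → SubdiffusiveBondHeat → ExtensiveSnapshotIrreversibility →
LinearResponseFTUR → NessUnique → FiniteResponseOfUnique → PositiveOrInfiniteLimit → FouriersLaw
(the sub-problem Statement decl, by name); PROVED as `theorem closes` (D-0027 §2.1). -/
@[route_item "route-AtomisticToContinuum-BondHeatUncertainty"]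
def Assembly : Prop :=
  TransferToBoundedResponse → SubdiffusiveBondHeat → ExtensiveSnapshotIrreversibility → LinearResponseFTUR → NessUnique → FiniteResponseOfUnique → PositiveOrInfiniteLimit → FouriersLaw

/-! D-0027 §2.1 — DECIDING THEOREM (planner-authored via `route open/edit --closes-file`; by planner-rrepair-AtomisticToContinuum-BondHeatU-d5aca795-g2-0 2026-08-15T16:29:03Z):
its hypotheses are this route's items and its conclusion the sub-problem Statement (glue_lint), and it elaborates with this file. -/

/-- D-0027 §2.1 DECIDING THEOREM of route BondHeatUncertainty (card lr-ftur-conductance-scaling):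
the transfer glue, the three cruxes (S), (K), (★), weak-NESS uniqueness, existence of the response
limits and the import slot (limit of `D_N` in `(0, +∞]`) decide the sub-problem Statement
`FouriersLaw`. Proof: `TransferToBoundedResponse` gives bounded response; clause (i) from the PROVED
fact `CuneoEckmannHairerReyBellet2018_pinnedChain` (`N ≥ 1`) / `isSteadyState_zero` (`N = 0`) +
uniqueness; clause (ii): along the canonical family the EReal limit `ℓ ∈ (0,+∞]` of `D_N` is
`≤ sup |D_N| < ⊤`, hence real and positive =: `κ T`; uniqueness transfers the `δ`-limits to every
steady-state family. -/
@[closes "route-AtomisticToContinuum-BondHeatUncertainty"] theorem closes : TransferToBoundedResponse → SubdiffusiveBondHeat → ExtensiveSnapshotIrreversibility →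
    LinearResponseFTUR → NessUnique → FiniteResponseOfUnique → PositiveOrInfiniteLimit →
    FouriersLaw := by
  intro hT hS hK hF hU hR hL
  have hB : BoundedResponse := hT hS hK hF hU
  show ∀ ω₂ lam β γ : ℝ, 0 < ω₂ → 0 < lam → 0 < β → 0 < γ →
    (Literature.MathematicalPhysics.KineticTheory.HeatConduction.pinnedChain ω₂ lam β γ).FouriersLawFor
  intro ω₂ lam β γ hω hl hβ hγ
  have huniq := hU ω₂ lam β γ hω hl hβ hγ
  -- clause (i): existence (landed fact, proved in tree) + uniqueness
  have hex : ∀ (N : ℕ) (T_L T_R : ℝ), 0 < T_L → 0 < T_R →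
      ∃ μ : MeasureTheory.Measure (Literature.MathematicalPhysics.KineticTheory.HeatConduction.PhaseSpace N),
        (Literature.MathematicalPhysics.KineticTheory.HeatConduction.pinnedChain ω₂ lam β γ).IsSteadyState N T_L T_R μ := by
    intro N T_L T_R hL' hR'
    rcases Nat.eq_zero_or_pos N with rfl | hN
    · exact ⟨_, Literature.MathematicalPhysics.KineticTheory.HeatConduction.OscillatorChain.isSteadyState_zero _ _ _⟩
    · exact Literature.MathematicalPhysics.KineticTheory.HeatConduction.CuneoEckmannHairerReyBellet2018_pinnedChain_holds.exists_isSteadyState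
        hω hl hβ hγ hN hL' hR'
  refine ⟨fun N T_L T_R hL' hR' => ?_, ?_⟩
  · obtain ⟨μ, hμ⟩ := hex N T_L T_R hL' hR'
    exact ⟨μ, hμ, fun ν hν => huniq N T_L T_R hL' hR' ν μ hν hμ⟩
  -- clause (ii): the canonical family
  classical
  let μ₀ : (N : ℕ) → ℝ → ℝ →
      MeasureTheory.Measure (Literature.MathematicalPhysics.KineticTheory.HeatConduction.PhaseSpace N) :=
    fun N T_L T_R => if h : 0 < T_L ∧ 0 < T_R then Classical.choose (hex N T_L T_R h.1 h.2) else 0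
  have hμ₀ : ∀ (N : ℕ) (T_L T_R : ℝ), 0 < T_L → 0 < T_R →
      (Literature.MathematicalPhysics.KineticTheory.HeatConduction.pinnedChain ω₂ lam β γ).IsSteadyState N T_L T_R (μ₀ N T_L T_R) := by
    intro N T_L T_R hL' hR'
    simp only [μ₀, dif_pos (And.intro hL' hR')]
    exact Classical.choose_spec (hex N T_L T_R hL' hR')
  -- for every T > 0: response coefficients along μ₀, their positive-or-infinite limit, boundedness
  have key : ∀ T : ℝ, 0 < T → ∃ κT : ℝ, 0 < κT ∧ ∃ D : ℕ → ℝ,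
      (∀ N : ℕ, Filter.Tendsto (fun δ : ℝ =>
        (Literature.MathematicalPhysics.KineticTheory.HeatConduction.pinnedChain ω₂ lam β γ).totalCurrent
          (μ₀ N (T + δ / 2) (T - δ / 2)) / δ) (nhdsWithin 0 {(0 : ℝ)}ᶜ) (nhds (D N))) ∧
      Filter.Tendsto D Filter.atTop (nhds κT) := by
    intro T hT
    have hDex := hR ω₂ lam β γ hω hl hβ hγ huniq μ₀ hμ₀ T hT
    choose D hD using hDex
    obtain ⟨ℓ, hℓpos, hℓ⟩ := hL ω₂ lam β γ hω hl hβ hγ huniq μ₀ hμ₀ T hT D hD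
    obtain ⟨S, hSub⟩ := hB ω₂ lam β γ hω hl hβ hγ μ₀ hμ₀ T hT D hD
    have hDle : ∀ N : ℕ, ((D N : ℝ) : EReal) ≤ ((S : ℝ) : EReal) := fun N =>
      EReal.coe_le_coe_iff.2 ((le_abs_self _).trans (hSub ⟨N, rfl⟩))
    have hℓle : ℓ ≤ ((S : ℝ) : EReal) := le_of_tendsto' hℓ hDle
    have hℓtop : ℓ ≠ ⊤ := ne_top_of_le_ne_top (EReal.coe_ne_top S) hℓle
    have hℓbot : ℓ ≠ ⊥ := ne_bot_of_gt hℓpos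
    have hcoe : ((ℓ.toReal : ℝ) : EReal) = ℓ := EReal.coe_toReal hℓtop hℓbot
    refine ⟨ℓ.toReal, ?_, D, hD, ?_⟩
    · have h0 : ((0 : ℝ) : EReal) < ((ℓ.toReal : ℝ) : EReal) := by
        rw [hcoe]; exact_mod_cast hℓpos
      exact EReal.coe_lt_coe_iff.1 h0
    · have h' : Filter.Tendsto (fun N : ℕ => ((D N : ℝ) : EReal)) Filter.atTop (nhds ((ℓ.toReal : ℝ) : EReal)) := by
        rw [hcoe]; exact hℓ
      exact EReal.tendsto_coe.1 h'
  choose κf hκpos Df hDf hDlim using key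
  refine ⟨fun T => if hT : 0 < T then κf T hT else 1, fun T hT => ?_, ?_⟩
  · simp only [dif_pos hT]; exact hκpos T hT
  intro μ hμ T hT
  refine ⟨Df T hT, fun N => ?_, ?_⟩
  · refine (hDf T hT N).congr' ?_
    have h2 : ∀ᶠ δ in nhds (0 : ℝ), δ < 2 * T := eventually_lt_nhds (by linarith)
    have h2' : ∀ᶠ δ in nhds (0 : ℝ), -(2 * T) < δ := eventually_gt_nhds (by linarith)
    filter_upwards [mem_nhdsWithin_of_mem_nhds h2, mem_nhdsWithin_of_mem_nhds h2'] with δ hlt hgt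
    have ha : 0 < T + δ / 2 := by linarith
    have hb : 0 < T - δ / 2 := by linarith
    rw [huniq N _ _ ha hb (μ₀ N _ _) (μ N _ _) (hμ₀ N _ _ ha hb) (hμ N _ _ ha hb)]
  · simp only [dif_pos hT]; exact hDlim T hT

end Summit.AtomisticToContinuum.FouriersLaw.Theses.BondHeatUncertainty
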